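import Mathlib
import HarnessLib
import Literature.AlgebraicGeometry.Resolution.BlowupDimension
import Literature.AlgebraicGeometry.Resolution.BlowupAxialPoint
import Summits.ResolutionOfSingularities.ResolutionOfSingularities.Theorems.WildQuotientsWildQuotientResolutionKSCentreRegularFixedPoint
import Summits.ResolutionOfSingularities.ResolutionOfSingularities.Theorems.WildQuotientsWildQuotientResolutionKSCentreMonoidalTransformOfPrime
import Summits.ResolutionOfSingularities.ResolutionOfSingularities.Theorems.WildQuotientsWildQuotientResolutionKSCentreMonoidalTransformDim

/-!
# Kollár–Szabó going down, (K2-centres): the fixed point on the blow-up along a regular stable centre is a CLOSED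
# REGULAR point of the same dimension (crux `WildQuotients.WildQuotientResolution`, stub `stub_phaseZeroHighDim`)

Crux stmt-ResolutionOfSingularities-15640 (`WildQuotientResolution`), registered stub `stub_phaseZeroHighDim`;
programme PHASE0-KS-EIGENLINE, item (K2-centres-dim): thread the dimension bound of the monoidal transform
(✓`le_ringKrullDim_ofPrime_closure_chart`, p831265, through ✓`exists_equivariant_monoidalTransform_ofPrime`, p831276)
into the ring-level glue and finish hand 8-g2's pattern (✓`KSBlowupFixedPointDim.exists_closed_regular_fixedPoint_liftAction`
for point blow-ups) for REGULAR POSITIVE-DIMENSIONAL STABLE CENTRES: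

* `exists_equivariant_monoidalTransform_of_action_dim` — the glue with localisation datum AND `d ≤ dim R`;
* ★ `exists_closed_regular_fixedPoint_liftAction_of_regularCentre` — **X integral locally Noetherian, G ABELIAN with
  `g ∈ I_x` ∀ g at a CLOSED point `x` with `𝒪_{X,x}` regular and `κ(x) = κ̄`, `I` a `σ`-stable ideal sheaf whose stalk
  `I_x ≠ 0` is generated by part of a regular system of parameters, `π : X' → X` ANY blow-up along `I` (`X'` integral)
  with the LIFTED action ⇒ a CLOSED point `x'` over `x` with `g ∈ I_{x'}` for every `g`, `𝒪_{X',x'}` REGULAR and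
  `dim 𝒪_{X',x'} = dim 𝒪_{X,x}`.**

Not here (census): `κ(x') ≅ κ(x)` (from the `same residue field` clause, as in hand 8-g2's `…_step`), the p-closed twin
(swap in ✓`KSCentrePClosed` / ✓`KSCentreRegularFixedPointPClosed`), and `IsLocallyNoetherian X'`/`IsIntegral X'` from
`hπ` (✓`IsBlowup.isIntegral`).

[OURS · crux stmt-ResolutionOfSingularities-15640 · helper toward `stub_phaseZeroHighDim` ((K2-centres) closed regular
fixed point; NOT a proof of the stub); counted 0; AI-level work, weaker than expert review.]
[cite: ReichsteinYoussin2000, Appendix (Kollár–Szabó), proof of Prop. A.2] [cite: Liu2002, Thm. 8.1.19 (a)]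
-/

-- single-problem summit: the doubled namespace component `ResolutionOfSingularities` is forced
set_option linter.dupNamespace false

noncomputable section

open CategoryTheory CategoryTheory.Limits AlgebraicGeometry TopologicalSpace IsLocalRing
open Literature.AlgebraicGeometry.Ramification Literature.AlgebraicGeometry.Resolution
open Scheme.IdealSheafData
open Summit.ResolutionOfSingularities.ResolutionOfSingularities.Theorems.WildQuotientResolution

namespace Summit.ResolutionOfSingularities.ResolutionOfSingularities.Theorems.WildQuotientResolution.CentreChart

universe u

/-- **The equivariant monoidal transform of a regular local domain along a stable regular centre, with its action and
its LOCALISATION DATUM and DIMENSION BOUND.**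
Let `A` be a regular local domain with algebraically closed residue field, `x : Fin d → A` a regular system of
parameters (`(x) = 𝔪`, `d` the embedding dimension), `e : Fin m → Fin d` injective with `J = (x ∘ e) ≠ 0` — a
regular centre through the closed point — and let an abelian group `I` act on `A` by ring automorphisms `τ_g` with
`τ_g a − a ∈ 𝔪_A` and `τ_g J ⊆ J`. Then there are: a local subring `R` of `K = Frac A`, REGULAR, an injective
local ring map `ι : A → R` (the inclusion), an element `t ∈ R`, `t ≠ 0`, with `J · R = (t)`, and ring
endomorphisms `α_g` of `R` with `α_g ∘ ι = ι ∘ τ_g` and `α_g r − r ∈ 𝔪_R`; and every `r ∈ R` is congruent modulo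
`𝔪_R` to some `ι a`. This is the Kollár–Szabó fixed point `[W]` of the blow-up of `Spec A` along `V(J)` over the
closed point, as a local ring with its induced action; in addition (for the stalk identification
✓`CentreChart.nonempty_stalk_ringEquiv_of_localizedChart`): `t = ι a₀` for some `a₀ ∈ J`, and every `r ∈ R` is `a/b`
with `a, b` in the chart ring `im(A)[J/a₀] ⊆ Frac A` and `b⁻¹ ∈ R`. [cite: ReichsteinYoussin2000, Appendix, proof of Prop. A.2]
[cite: Liu2002, Thm. 8.1.19 (a)] -/
theorem exists_equivariant_monoidalTransform_of_action_dim {A : Type u} [CommRing A] [IsDomain A]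
    [IsRegularLocalRing A] [IsAlgClosed (ResidueField A)]
    {d m : ℕ} (hd : (maximalIdeal A).spanFinrank = d) (x : Fin d → A)
    (hx : Ideal.span (Set.range x) = maximalIdeal A) (e : Fin m → Fin d) (he : Function.Injective e)
    (hJ0 : Ideal.span (Set.range (x ∘ e)) ≠ ⊥)
    {I : Type*} [CommGroup I] (τ : I →* (A ≃+* A)) (hres : ∀ (g : I) (a : A), τ g a - a ∈ maximalIdeal A)
    (hJ : ∀ g : I, ∀ a ∈ Ideal.span (Set.range (x ∘ e)), τ g a ∈ Ideal.span (Set.range (x ∘ e))) :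
    ∃ (R : Subring (FractionRing A)) (_ : IsLocalRing R) (ι : A →+* R) (_ : IsLocalHom ι) (t : R)
      (α : I → (R →+* R)),
      IsRegularLocalRing R ∧ (d : WithBot ℕ∞) ≤ ringKrullDim R ∧
      (∀ a : A, ((ι a : R) : FractionRing A) = algebraMap A (FractionRing A) a) ∧
      Function.Injective ι ∧ t ≠ 0 ∧ (Ideal.span (Set.range (x ∘ e))).map ι = Ideal.span {t} ∧
      (∀ g : I, (α g).comp ι = ι.comp (τ g : A →+* A)) ∧
      (∀ (g : I) (r : R), α g r - r ∈ maximalIdeal R) ∧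
      (∀ r : R, ∃ a : A, ι a - r ∈ maximalIdeal R) ∧
      ∃ a₀ : A, a₀ ∈ Ideal.span (Set.range (x ∘ e)) ∧ ι a₀ = t ∧
        ∀ r : R, ∃ a b : FractionRing A,
          a ∈ Subring.closure (((algebraMap A (FractionRing A)).range : Set (FractionRing A)) ∪
            {z | ∃ m ∈ Ideal.span (Set.range (x ∘ e)),
              z = algebraMap A (FractionRing A) m / algebraMap A (FractionRing A) a₀}) ∧
          b ∈ Subring.closure (((algebraMap A (FractionRing A)).range : Set (FractionRing A)) ∪
            {z | ∃ m ∈ Ideal.span (Set.range (x ∘ e)),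
              z = algebraMap A (FractionRing A) m / algebraMap A (FractionRing A) a₀}) ∧
          b⁻¹ ∈ R ∧ (r : FractionRing A) = a / b := by
  -- verbatim `exists_equivariant_monoidalTransform_of_action_frac` (hand 8-g3) with the origin `𝔫` kept and the
  -- dimension bound ✓`le_ringKrullDim_ofPrime_closure_chart` threaded through
  obtain ⟨m', rfl⟩ : ∃ m', m = m' + 1 := by
    cases m with
    | zero =>
      exfalso
      apply hJ0
      rw [Set.range_eq_empty, Ideal.span_empty]
    | succ m' => exact ⟨m', rfl⟩
  classical
  -- the model `S = image of A` in `K = Frac A`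
  let K := FractionRing A
  let f : A →+* K := algebraMap A K
  have hf : Function.Injective f := IsFractionRing.injective A K
  let S : Subring K := f.range
  have hrr : Function.Injective f.rangeRestrict := fun a b h => hf (congrArg Subtype.val h)
  let e₀ : A ≃+* S := RingEquiv.ofBijective f.rangeRestrict ⟨hrr, RingHom.rangeRestrict_surjective f⟩
  have he₀ : ∀ a : A, ((e₀ a : S) : K) = f a := fun a => rfl
  haveI : IsRegularLocalRing S := IsRegularLocalRing.of_ringEquiv e₀
  haveI : IsAlgClosed (ResidueField S) :=
    IsAlgClosed.of_ringEquiv (ResidueField A) (ResidueField S) (ResidueField.mapEquiv e₀)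
  have heS : ∀ (s : S), ∃ a : A, s = e₀ a := fun s => ⟨e₀.symm s, (e₀.apply_symm_apply s).symm⟩
  -- the transported coordinates
  let xS : Fin d → S := fun k => e₀ (x k)
  have hmapx : (Ideal.span (Set.range x)).map (e₀ : A →+* S) = Ideal.span (Set.range xS) := by
    rw [Ideal.map_span, ← Set.range_comp]
    rfl
  have hxS : Ideal.span (Set.range xS) = maximalIdeal S := by
    rw [← hmapx, hx]
    exact map_ringEquiv_maximalIdeal e₀
  have hdS : (maximalIdeal S).spanFinrank = d := by
    rw [← map_ringEquiv_maximalIdeal e₀, Ideal.spanFinrank_map_eq_of_ringEquiv, hd]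
  have hmapJ : (Ideal.span (Set.range (x ∘ e))).map (e₀ : A →+* S) = Ideal.span (Set.range (xS ∘ e)) := by
    rw [Ideal.map_span, ← Set.range_comp]
    rfl
  have hmemJS : ∀ s : S, s ∈ Ideal.span (Set.range (xS ∘ e)) ↔ e₀.symm s ∈ Ideal.span (Set.range (x ∘ e)) := by
    intro s
    rw [← hmapJ, Ideal.map_comap_of_equiv, Ideal.mem_comap]
  have hJS0 : Ideal.span (Set.range (xS ∘ e)) ≠ ⊥ := by
    intro h0
    apply hJ0
    rw [← Ideal.map_eq_bot_iff_of_injective (f := (e₀ : A →+* S)) e₀.injective, hmapJ, h0]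
  -- the transported action on `S` and the extended action on `K`
  obtain ⟨τS, hτS⟩ := KSGoingDown.exists_transport_action e₀ τ
  have hresS : ∀ (g : I) (s : S), τS g s - s ∈ maximalIdeal S :=
    KSGoingDown.transport_residueTrivial e₀ τ hres τS hτS
  have hJS : ∀ g : I, ∀ s ∈ Ideal.span (Set.range (xS ∘ e)), τS g s ∈ Ideal.span (Set.range (xS ∘ e)) := by
    intro g s hs
    rw [hmemJS] at hs ⊢
    rw [hτS, e₀.symm_apply_apply]
    exact hJ g _ hs
  let σK : I → (K ≃+* K) := fun g => IsFractionRing.ringEquivOfRingEquiv (τ g)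
  have hσK : ∀ (g : I) (a : A), σK g (f a) = f (τ g a) := fun g a =>
    IsFractionRing.ringEquivOfRingEquiv_algebraMap (τ g) a
  have hσS : ∀ g : I, ∀ s ∈ S, σK g s ∈ S := by
    rintro g _ ⟨a, rfl⟩
    exact ⟨τ g a, (hσK g a).symm⟩
  have hσS' : ∀ (g : I) (s : S), (⟨σK g s, hσS g s s.2⟩ : S) = τS g s := by
    intro g s
    obtain ⟨a, rfl⟩ := heS s
    apply Subtype.ext
    change σK g (f a) = ((τS g (e₀ a) : S) : K)
    rw [hσK, hτS, e₀.symm_apply_apply, he₀]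
  -- adapted coordinates `x'`, the stable hyperplane `W`, unit eigenvalues (hand 8-g3, ✓`KSCentreAdaptedGenerators`)
  obtain ⟨x', i, W, hx', hx'J, -, hWJ, hWle, hti, hx'W, hWle', hstab, hunit⟩ :=
    CentreEigenline.exists_adapted_generators_of_stable_centre τS hresS xS hxS e he hJS0 hJS
  -- the centre coordinates `y = x' ∘ e`, `t = y i`
  let y : Fin (m' + 1) → S := fun j => x' (e j)
  have hyJ' : Ideal.span (Set.range y) = Ideal.span (Set.range (xS ∘ e)) := hx'J
  have hyi : y i ≠ 0 := by
    intro h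
    apply hti
    change y i ∈ W
    rw [h]
    exact W.zero_mem
  have hym : ∀ j, y j ∈ maximalIdeal S := fun j => hx' ▸ Ideal.subset_span ⟨e j, rfl⟩
  have hqr : IsQuasiRegular y := isQuasiRegular_rsop_comp hdS x' hx' e he
  have hWle'' : W ≤ Ideal.span (y '' {j | j ≠ i}) ⊔ maximalIdeal S * Ideal.span (Set.range y) := by
    rw [hyJ']
    exact hWle'
  have hres' : ∀ (g : I) (s : S), (⟨σK g s, hσS g s s.2⟩ : S) - s ∈ maximalIdeal S := fun g s => by
    rw [hσS']
    exact hresS g s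
  have hWσ : ∀ (g : I) (j : Fin (m' + 1)), j ≠ i → (⟨σK g ((y j : S) : K), hσS g _ (y j).2⟩ : S) ∈ W :=
    fun g j hj => by
    rw [hσS']
    exact hstab g _ (hx'W j hj)
  have ht' : ∀ g : I, ∃ u : S, IsUnit u ∧ (⟨σK g ((y i : S) : K), hσS g _ (y i).2⟩ : S) - u * y i ∈ W :=
    fun g => by
    rw [hσS']
    exact hunit g
  -- hand 8-g3: the stable monoidal transform
  obtain ⟨𝔫, h𝔫, -, -, hnjn, hovern, -, hSR, hdom, htinv, hJR, -, hstabR, hresR, hcongR, hregR, hfracR⟩ :=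
    exists_equivariant_monoidalTransform_ofPrime S y hqr hym i hyi hWle'' σK hσS hres' hWσ ht'
  let R₁ : LocalSubring K := LocalSubring.ofPrime
    (Subring.closure ((S : Set K) ∪ Set.range fun j => ((y j : S) : K) / ((y i : S) : K))) 𝔫
  have hreg : IsRegularLocalRing R₁.toSubring :=
    hregR (isRegularRing_closure_monoidalChart S hdS x' hx' e he i)
  have hdimR : (d : WithBot ℕ∞) ≤ ringKrullDim R₁.toSubring :=
    @le_ringKrullDim_ofPrime_closure_chart K _ S _ d m' hdS x' hx' e he i hyi 𝔫 h𝔫 hovern hnjn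
  -- the structure map `ι : A → R₁`
  let ι : A →+* R₁.toSubring := (Subring.inclusion hSR).comp (e₀ : A →+* S)
  have hι : ∀ a : A, ((ι a : R₁.toSubring) : K) = f a := fun a => rfl
  have hιinj : Function.Injective ι := fun a b h => hf (by rw [← hι, ← hι, h])
  haveI hloc : IsLocalHom ι := by
    refine ⟨fun a ha => ?_⟩
    obtain ⟨h0, hinv⟩ := (isUnit_subring_iff_inv_mem (ι a)).mp ha
    rw [hι] at h0 hinv
    have hnot : e₀ a ∉ maximalIdeal S := fun hm => by
      rcases (hdom (e₀ a)).mp hm with h | h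
      · exact h0 h
      · exact h hinv
    have hu : IsUnit (e₀ a) := by
      by_contra hu
      exact hnot ((IsLocalRing.mem_maximalIdeal _).mpr (mem_nonunits_iff.mpr hu))
    simpa using hu.map e₀.symm
  -- the element `t = y i` read in `R₁` and `J R₁ = (t)`
  let tR : R₁.toSubring := ⟨((y i : S) : K), hSR (y i).2⟩
  have htR0 : tR ≠ 0 := by
    intro h
    have h' : ((y i : S) : K) = 0 := congrArg Subtype.val h
    exact hyi (Subtype.ext h')
  have hyi0 : ((y i : S) : K) ≠ 0 := fun h => hyi (Subtype.ext h)
  have hmap : (Ideal.span (Set.range (x ∘ e))).map ι = Ideal.span {tR} := by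
    change (Ideal.span (Set.range (x ∘ e))).map ((Subring.inclusion hSR).comp (e₀ : A →+* S)) = _
    rw [← Ideal.map_map, hmapJ, ← hyJ', Ideal.map_span]
    apply le_antisymm
    · refine Ideal.span_le.mpr ?_
      rintro _ ⟨_, ⟨j, rfl⟩, rfl⟩
      have hq : ((y j : S) : K) / ((y i : S) : K) ∈ R₁.toSubring := hJR (y j) (Ideal.subset_span ⟨j, rfl⟩)
      refine Ideal.mem_span_singleton'.mpr ⟨⟨_, hq⟩, Subtype.ext ?_⟩
      change ((y j : S) : K) / ((y i : S) : K) * ((y i : S) : K) = ((y j : S) : K)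
      exact div_mul_cancel₀ _ hyi0
    · refine Ideal.span_le.mpr ?_
      rintro _ rfl
      exact Ideal.subset_span ⟨y i, ⟨i, rfl⟩, rfl⟩
  -- the restricted endomorphisms
  let α : I → (R₁.toSubring →+* R₁.toSubring) := fun g => (σK g : K →+* K).restrict _ _ (hstabR g)
  have hα : ∀ (g : I) (r : R₁.toSubring), ((α g r : R₁.toSubring) : K) = σK g r := fun g r => rfl
  -- the localisation datum: `a₀ = e₀⁻¹ (y i)` and the chart ring inside `im(A)[J/a₀]`
  have hyjJ : ∀ j, e₀.symm (y j) ∈ Ideal.span (Set.range (x ∘ e)) := fun j => by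
    rw [← hmemJS, ← hyJ']
    exact Ideal.subset_span ⟨j, rfl⟩
  have hfy : ∀ j, f (e₀.symm (y j)) = ((y j : S) : K) := fun j => by
    rw [← he₀, e₀.apply_symm_apply]
  have hCle : Subring.closure ((S : Set K) ∪ Set.range fun j => ((y j : S) : K) / ((y i : S) : K)) ≤
      Subring.closure (((algebraMap A (FractionRing A)).range : Set (FractionRing A)) ∪
        {z | ∃ m ∈ Ideal.span (Set.range (x ∘ e)),
          z = algebraMap A (FractionRing A) m / algebraMap A (FractionRing A) (e₀.symm (y i))}) := by
    refine Subring.closure_mono ?_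
    rintro z (hz | ⟨j, rfl⟩)
    · exact Or.inl hz
    · refine Or.inr ⟨e₀.symm (y j), hyjJ j, ?_⟩
      change ((y j : S) : K) / ((y i : S) : K) = f (e₀.symm (y j)) / f (e₀.symm (y i))
      rw [hfy, hfy]
  refine ⟨R₁.toSubring, inferInstance, ι, hloc, tR, α, hreg, hdimR, hι, hιinj, htR0, hmap, fun g => ?_,
    fun g r => ?_, fun r => ?_, e₀.symm (y i), hyjJ i, Subtype.ext (by rw [hι, hfy]), fun r => ?_⟩
  · ext a
    change σK g (f a) = f (τ g a)
    exact hσK g a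
  · rw [mem_maximalIdeal_iff_inv_not_mem]
    have e1 : ((α g r - r : R₁.toSubring) : K) = σK g r - r := by rw [AddSubgroupClass.coe_sub, hα]
    rw [e1]
    exact hresR g r r.2
  · obtain ⟨s, hs, hrs⟩ := hcongR r r.2
    obtain ⟨a, ha⟩ := heS ⟨s, hs⟩
    have ha : ((e₀ a : S) : K) = s := (congrArg Subtype.val ha).symm
    refine ⟨a, ?_⟩
    have e2 : ι a - r = -(r - ι a) := by ring
    rw [e2]
    refine neg_mem_iff.mpr ?_
    rw [mem_maximalIdeal_iff_inv_not_mem]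
    have e3 : ((r - ι a : R₁.toSubring) : K) = (r : K) - s := by
      rw [AddSubgroupClass.coe_sub, hι, ← he₀, ← ha]
    rw [e3]
    exact hrs
  · obtain ⟨a, haC, b, hbC, hbinv, hrab⟩ := hfracR r r.2
    exact ⟨a, b, hCle haC, hCle hbC, hbinv, hrab⟩


/-- **The Kollár–Szabó fixed point on the blow-up along a regular stable centre is a CLOSED REGULAR point of the same
dimension.** Let `X` be an integral locally Noetherian scheme, `G` an ABELIAN group acting with `g ∈ I_x` for all `g`
at a CLOSED point `x` whose local ring is regular (embedding dimension `d`) with algebraically closed residue field,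
`I` a `σ`-stable ideal sheaf whose stalk `I_x ≠ 0` is generated by part `xs ∘ e` of a regular system of parameters
`xs` (a REGULAR centre through `x`), and `π : X' → X` a blowing up along `I` with `X'` integral, carrying the lifted
action. Then there is a CLOSED point `x' ∈ X'` over `x`, in the inertia group of every `g`, with `𝒪_{X',x'}` regular
of dimension `dim 𝒪_{X,x}` (`≤`: ✓`IsBlowup.ringKrullDim_stalk_le`; `≥`: ✓`le_ringKrullDim_ofPrime_closure_chart`;
closed: ✓`IsBlowup.isClosed_singleton_axialPoint`). Only `κ(x') ≅ κ(x)` separates this from the full step.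
[cite: ReichsteinYoussin2000, Appendix (Kollár–Szabó), proof of Prop. A.2] [cite: Liu2002, Thm. 8.1.19 (a)] -/
theorem exists_closed_regular_fixedPoint_liftAction_of_regularCentre {X : Scheme.{0}} [IsIntegral X]
    [IsLocallyNoetherian X] {G : Type} [CommGroup G] (σ : G →* Aut X) {x : X} (hxc : IsClosed ({x} : Set X))
    (hGx : ∀ g, g ∈ inertiaSubgroup σ x)
    [IsRegularLocalRing (X.presheaf.stalk x)] [IsAlgClosed (ResidueField (X.presheaf.stalk x))]
    {I : X.IdealSheafData} (hI : ∀ g, I.comap (σ g).hom = I)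
    {d m : ℕ} (hd : (maximalIdeal (X.presheaf.stalk x)).spanFinrank = d) (xs : Fin d → X.presheaf.stalk x)
    (hxs : Ideal.span (Set.range xs) = maximalIdeal (X.presheaf.stalk x))
    (e : Fin m → Fin d) (he : Function.Injective e)
    (hIx : stalkIdeal I x = Ideal.span (Set.range (xs ∘ e))) (hIx0 : stalkIdeal I x ≠ ⊥)
    {X' : Scheme.{0}} [IsIntegral X'] {π : X' ⟶ X} (hπ : IsBlowup π I) :
    ∃ x' : X', π x' = x ∧ IsClosed ({x'} : Set X') ∧ (∀ g, g ∈ inertiaSubgroup (hπ.liftAction σ hI) x') ∧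
      IsRegularLocalRing (X'.presheaf.stalk x') ∧
      ringKrullDim (X'.presheaf.stalk x') = ringKrullDim (X.presheaf.stalk x) := by
  -- the stalk action of `G = I_x`, its residue-triviality and the stability of `I_x`
  obtain ⟨a, τ, hkey, hτ⟩ := PointBlowupStalkData.exists_stalkAction σ x (⊤ : Subgroup G)
    (fun g _ => apply_eq_of_mem_inertiaSubgroup σ (hGx g))
  have htop : (⊤ : Subgroup G) ≤ inertiaSubgroup σ x := fun g _ => hGx g
  have hresO : ∀ (g : (⊤ : Subgroup G)) (s : X.presheaf.stalk x), τ g s - s ∈ maximalIdeal _ :=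
    InertLocusStalk.stalkAction_residueTrivial σ x a τ hkey hτ htop
  have hstabI : ∀ (g : (⊤ : Subgroup G)), ∀ r ∈ stalkIdeal I x, (a g).hom r ∈ stalkIdeal I x :=
    stalkIdeal_stable_of_stalkAction σ ⊤ (fun g _ => apply_eq_of_mem_inertiaSubgroup σ (hGx g)) a hkey hI
  have hJτ : ∀ g : (⊤ : Subgroup G), ∀ r ∈ Ideal.span (Set.range (xs ∘ e)),
      τ g r ∈ Ideal.span (Set.range (xs ∘ e)) := by
    intro g r hr
    rw [← hIx] at hr ⊢
    rw [hτ]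
    exact hstabI g⁻¹ r hr
  have hJ0 : Ideal.span (Set.range (xs ∘ e)) ≠ ⊥ := hIx ▸ hIx0
  -- the equivariant monoidal transform with its localisation datum and dimension bound
  obtain ⟨R, hRloc, ι, hιloc, t, α, hreg, hdimR, hι, hιinj, ht0, hmap, hα, hres, -, a₀, ha₀J, ha₀t, hfrac⟩ :=
    exists_equivariant_monoidalTransform_of_action_dim hd xs hxs e he hJ0 τ hresO hJτ
  -- repackage over `G`
  let a' : G → (X.presheaf.stalk x ⟶ X.presheaf.stalk x) := fun g => a ⟨g, Subgroup.mem_top g⟩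
  have hkey' : ∀ g, Spec.map (a' g) ≫ X.fromSpecStalk x = X.fromSpecStalk x ≫ (σ g).hom := fun g =>
    hkey ⟨g, Subgroup.mem_top g⟩
  let α' : G → (R →+* R) := fun g => α ⟨g⁻¹, Subgroup.mem_top _⟩
  have hα' : ∀ g, (α' g).comp ι = ι.comp (a' g).hom := by
    intro g
    have hinv : (⟨g⁻¹, Subgroup.mem_top _⟩ : (⊤ : Subgroup G))⁻¹ = ⟨g, Subgroup.mem_top g⟩ :=
      Subtype.ext (inv_inv g)
    refine (hα ⟨g⁻¹, Subgroup.mem_top _⟩).trans ?_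
    ext s
    change ((ι (τ ⟨g⁻¹, Subgroup.mem_top _⟩ s) : R) : FractionRing (X.presheaf.stalk x)) =
      ((ι ((a ⟨g, Subgroup.mem_top g⟩).hom s) : R) : FractionRing (X.presheaf.stalk x))
    rw [hτ, hinv]
  have hres' : ∀ (g : G) (r : R), α' g r - r ∈ maximalIdeal R := fun g r => hres _ r
  have htnz : t ∈ nonZeroDivisors R := mem_nonZeroDivisors_of_ne_zero ht0
  have hmapI : (stalkIdeal I x).map ι = Ideal.span {t} := by rw [hIx]; exact hmap
  -- the local chart and its fixed point
  obtain ⟨φ, x', hφ, hφx', hx'x, hinert⟩ :=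
    KSGoingDown.exists_fixedPoint_liftAction_of_localChart_of_stalkIdeal hπ σ hI a' hkey' ι htnz hmapI α'
      hα' hres'
  -- the stalk identification `𝒪_{X',x'} ≅ R`
  have ha₀I : a₀ ∈ stalkIdeal I x := by rw [hIx]; exact ha₀J
  have ha₀0 : a₀ ≠ 0 := by
    rintro rfl
    exact ht0 (by rw [← ha₀t, map_zero])
  have hmapI' : (stalkIdeal I x).map ι = Ideal.span {ι a₀} := by rw [hmapI, ha₀t]
  set B : Subring (FractionRing (X.presheaf.stalk x)) := Subring.closure
      (((algebraMap (X.presheaf.stalk x) (FractionRing (X.presheaf.stalk x))).range : Set _) ∪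
        {z | ∃ m ∈ stalkIdeal I x, z = algebraMap _ (FractionRing (X.presheaf.stalk x)) m /
          algebraMap _ (FractionRing (X.presheaf.stalk x)) a₀}) with hB
  have hfracB : ∀ r : R, ∃ a ∈ B, ∃ b ∈ B, b⁻¹ ∈ R ∧ (r : FractionRing (X.presheaf.stalk x)) = a / b := by
    intro r
    obtain ⟨a, b, ha, hb, hbinv, hrab⟩ := hfrac r
    have hle : Subring.closure (((algebraMap (X.presheaf.stalk x) (FractionRing (X.presheaf.stalk x))).range :
          Set _) ∪ {z | ∃ m ∈ Ideal.span (Set.range (xs ∘ e)),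
            z = algebraMap _ (FractionRing (X.presheaf.stalk x)) m /
              algebraMap _ (FractionRing (X.presheaf.stalk x)) a₀}) ≤ B := by
      refine Subring.closure_mono ?_
      rintro z (hz | ⟨m, hm, rfl⟩)
      · exact Or.inl hz
      · exact Or.inr ⟨m, by rw [hIx]; exact hm, rfl⟩
    exact ⟨a, hle ha, b, hle hb, hbinv, hrab⟩
  haveI := hRloc
  haveI := hιloc
  haveI := hreg
  obtain ⟨eR⟩ := nonempty_stalk_ringEquiv_of_localizedChart hπ R ι hι ha₀I ha₀0 hmapI' B le_rfl hfracB φ hφ hφx'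
  have hregx' : IsRegularLocalRing (X'.presheaf.stalk x') := IsRegularLocalRing.of_ringEquiv eR.symm
  -- dimension: `d ≤ dim R = dim 𝒪_{X',x'} ≤ dim 𝒪_{X,x} = d`
  have hdimx : ringKrullDim (X.presheaf.stalk x) = d := by
    rw [← IsRegularLocalRing.spanFinrank_maximalIdeal, hd]
  have hdimeq : ringKrullDim (X'.presheaf.stalk x') = ringKrullDim (X.presheaf.stalk x) := by
    apply le_antisymm
    · have h := hπ.ringKrullDim_stalk_le x'
      rwa [hx'x] at h
    · rw [ringKrullDim_eq_of_ringEquiv eR, hdimx]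
      exact hdimR
  have hclosed : IsClosed ({x'} : Set X') := hπ.isClosed_singleton_axialPoint hx'x hxc hdimeq
  exact ⟨x', hx'x, hclosed, hinert, hregx', hdimeq⟩

end Summit.ResolutionOfSingularities.ResolutionOfSingularities.Theorems.WildQuotientResolution.CentreChart

end
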